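import Literature.AnabelianGeometry.EtaleTheta.ThetaRigidityShearCor218iiiPiX
import Literature.AnabelianGeometry.EtaleTheta.ThetaRigiditySchemaWitness
import HarnessLib

/-!
# [EtTh] Cor. 2.18 (iii), `Π^tp_X`-part, at the level of `ThetaEnvData` (FACT row F-0636): instance-PROVED (proof-only)

S. Mochizuki, *The Étale Theta Function …* [EtTh], Publ. RIMS **45** (2009), §2, Cor. 2.18 (iii) p. 61 (locators `p.N`
= PDF pages; bib key `MochizukiEtTh2009`).  PROOF-ONLY (cell `abc-iut`, seat abc-iut-w6-d089): the `ThetaEnvData`-level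
restatement `ThetaEnvData.Cor218_iii_PiX` (abc-iut-L2-t2, `ThetaRigidityLevels.lean`, row F-0636 = F-0622 along
`RigidData.cor218_iii_PiX_iff`) holds at the shear toy of `ThetaRigidityShearCor218iiiPiX.lean` (non-abelian `Π^tp_Y`);
its universal closure is refuted (abc-iut-w5-d175).  HONEST FRAMING: a satisfiability witness for the cell's typing,
nothing more; no side taken on [IUTchIII] Cor. 3.12; typed ≠ proved.
-/

namespace Literature.AnabelianGeometry.EtaleTheta

/-- **F-0636 instance-PROVED**: `ThetaEnvData.Cor218_iii_PiX` holds at some `ThetaEnvData 2` with non-abelian `Π^tp_Y`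
(the shear toy, transported along `RigidData.cor218_iii_PiX_iff`). [cite: MochizukiEtTh2009, Cor 2.18(iii) p.61] -/
theorem ThetaEnvData.exists_cor218_iii_PiX :
    ∃ T : ThetaEnvData.{0} 2, (∃ a b : T.PiY, a * b ≠ b * a) ∧
      Literature.AnabelianGeometry.EtaleTheta.ThetaEnvData.Cor218_iii_PiX T := by
  obtain ⟨R, hne, h⟩ := RigidData.exists_rigidData_cor218_iii_PiX
  exact ⟨R.toThetaEnvData, hne, (R.cor218_iii_PiX_iff).1 h⟩

/-- **F-0622 / F-0636 verdict shape**: universal closure REFUTED (w5-d175's `RigidData.Toy.not_forall_cor218_iii_PiX`,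
abelian toy) ∧ instance form PROVED (the shear toy) — a genuine hypothesis on the data, dischargeable instance by
instance (at the [EtTh] §1 model modulo temp-slimness, lane C2). [cite: MochizukiEtTh2009, Cor 2.18(iii) p.61] -/
theorem RigidData.cor218_iii_PiX_schema_verdict :
    (¬ ∀ (N : ℕ+) (l : ℕ) (R : RigidData.{0} N l),
        Literature.AnabelianGeometry.EtaleTheta.RigidData.Cor218_iii_PiX R) ∧
      ∃ R : RigidData.{0} 2 1, Literature.AnabelianGeometry.EtaleTheta.RigidData.Cor218_iii_PiX R :=
  ⟨RigidData.Toy.not_forall_cor218_iii_PiX,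
    let ⟨R, _, h⟩ := RigidData.exists_rigidData_cor218_iii_PiX; ⟨R, h⟩⟩

end Literature.AnabelianGeometry.EtaleTheta
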